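import Mathlib
import Summits.Ventures.HodgeRepro.Tier4.Line1.RTFSetting

/-!
# Tier4/Common/L1Convolution — the `L¹` test functions of a setting and their convolution calculus: Young's
inequality `L¹ ⋆ L¹ ⊆ L¹`, continuity of `L¹ ⋆ C_c`, the trivial bound `‖R(f)φ‖ ≤ ‖f‖₁ ‖φ‖_∞`, continuity of `R(f)φ`

Blind re-derivation cell `pub-hodge-repro`, Tier 4 «prove the step» (README §9–§10), seat t4-typer-2 (gen 4), on the
lead's GO (S14756, offer S14750 C-COMMON-L1CONV).  Target tree path
`lean/Summits/Ventures/HodgeRepro/Tier4/Common/L1Convolution.lean`.  Imports: Mathlib and `Line1.RTFSetting` (the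
abstract `RTF.Setting G`, its `conv`, `R`, `cj`, `refl`, `IsTest`).

WHY (plan-4 g4's §15, L4-MATH §15.3 / the statements file work/v33/L1Class-STATEMENTS.lean, lead S14756): the archimedean
isolation of LINE L4 now runs on a FIRST test function that is continuous and INTEGRABLE but not compactly supported
at `w₀` (the weight-3 discrete-series coefficient).  «Every `conv`/`cj`/`rightRegular` lemma used by the L4 cuts survives
for `L¹` functions» — this module is that sentence, generic over the setting:
* **`IsTestL1 S f := Continuous f ∧ Integrable f S.μ`** — THE class (plan-1 S14724 / plan-4 (0), one name for L1RTF and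
  D3COEFF to bind); `isTestL1_of_isTest`, `IsTestL1.cj`, `IsTestL1.norm_integrable`;
* `integrable_conv_integrand_prod` — `(h, x) ↦ f₁ h · f₂ (h⁻¹ x)` is integrable on `μ ⊗ μ` for `f₁, f₂ ∈ L¹` (the shear
  `(h, x) ↦ (h, h⁻¹ x)` preserves `μ ⊗ μ` by left invariance: Mathlib `measurePreserving_prod_inv_mul`);
* **`integrable_conv_of_integrable`** (`L¹ ⋆ L¹ ⊆ L¹`, Fubini) and **`integral_norm_conv_le`**
  (`‖f₁ ⋆ f₂‖₁ ≤ ‖f₁‖₁ ‖f₂‖₁`, Young);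
* **`continuous_conv_of_integrable_of_isTest`** — `f₁ ⋆ f₂` is continuous for `f₁ ∈ L¹` and a test function `f₂`
  (dominated convergence: `‖f₁ h‖ · sup ‖f₂‖` dominates); `isTestL1_conv` — `L¹ ⋆ C_c ⊆ L¹ ∩ C`;
* **`norm_R_le_of_integrable`** — `‖R(f)φ(y)‖ ≤ ‖f‖₁ · B` for `f ∈ L¹` and `‖φ‖ ≤ B` (the `IsTest` version is
  `RTF.Setting.norm_R_le`, RtfUnfold); `integrable_R_integrand_of_integrable`; **`continuous_R_of_integrable`** — `R(f)φ`
  is continuous for `f ∈ L¹` and a bounded continuous `φ` (dominated convergence; the `IsTest` version `continuous_R`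
  used the uniform continuity of `f`);
* `cj_conv`, `refl_conv` — `cj (f₁ ⋆ f₂) = cj f₁ ⋆ cj f₂` and `refl (f₁ ⋆ f₂) = refl f₂ ⋆ refl f₁` for ALL functions
  (conjugation commutes with the integral; the substitution `h ↦ g h` by left invariance).
NOT here (the lines' own analytic inputs, §15.4): the Poincaré-series domination / kernel convergence, the weight-3
coefficient, Schur orthogonality, the tail.

Nothing here says anything about the status of the Hodge conjecture for CM abelian varieties, which is NOT proved
(HC_CM is NOT proved by anyone in this repository).
-/

set_option autoImplicit false

noncomputable section

namespace Summit.Ventures.HodgeRepro.Tier4.Common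

open MeasureTheory Topology Filter Set Summit.Ventures.HodgeRepro.Tier4.Line1
  Summit.Ventures.HodgeRepro.Tier4.Line1.RTF
open scoped Pointwise ComplexConjugate

variable {G : Type} [Group G] [TopologicalSpace G] [IsTopologicalGroup G] [MeasurableSpace G] [BorelSpace G]
  (S : Setting G)

/-! ## 1. The class -/

/-- **An `L¹` test function of the setting**: continuous and integrable for the Haar measure `S.μ` (plan-1 S14724 /
plan-4 §15 (0) — the ONE name L1RTF and D3COEFF bind).  Compact support is NOT asked. -/
def IsTestL1 (f : G → ℂ) : Prop := Continuous f ∧ Integrable f S.μ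

omit [IsTopologicalGroup G] in
/-- A test function of compact support is an `L¹` test function (Haar measures are finite on compacts). -/
theorem isTestL1_of_isTest {f : G → ℂ} (hf : IsTest f) : IsTestL1 S f := by
  haveI := S.haar
  exact ⟨hf.cont, hf.cont.integrable_of_hasCompactSupport hf.compact⟩

omit [IsTopologicalGroup G] in
/-- The conjugate of an `L¹` test function is an `L¹` test function. -/
theorem IsTestL1.cj {f : G → ℂ} (hf : IsTestL1 S f) : IsTestL1 S (RTF.cj f) := by
  refine ⟨(continuous_star : Continuous (starRingEnd ℂ)).comp hf.1, ?_⟩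
  refine hf.2.norm.mono' ((continuous_star : Continuous (starRingEnd ℂ)).comp hf.1).aestronglyMeasurable ?_
  exact Eventually.of_forall fun g => by simp [RTF.cj]

omit [IsTopologicalGroup G] [BorelSpace G] in
/-- The norm of an `L¹` test function is integrable. -/
theorem IsTestL1.norm_integrable {f : G → ℂ} (hf : IsTestL1 S f) : Integrable (fun g => ‖f g‖) S.μ := hf.2.norm

/-! ## 2. Young: `L¹ ⋆ L¹ ⊆ L¹` -/

section Young

variable [SecondCountableTopology G] [SFinite S.μ]

/-- **The convolution integrand is integrable on `μ ⊗ μ`** for `f₁, f₂ ∈ L¹`: `(h, x) ↦ f₁ h · f₂ (h⁻¹ x)` is the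
product function `(h, u) ↦ f₁ h · f₂ u` composed with the measure-preserving shear `(h, x) ↦ (h, h⁻¹ x)`
(left invariance of `S.μ`). -/
theorem integrable_conv_integrand_prod {f₁ f₂ : G → ℂ} (h₁c : Continuous f₁) (h₁ : Integrable f₁ S.μ)
    (h₂c : Continuous f₂) (h₂ : Integrable f₂ S.μ) :
    Integrable (fun p : G × G => f₁ p.1 * f₂ (p.1⁻¹ * p.2)) (S.μ.prod S.μ) := by
  haveI := S.haar
  have hprod : Integrable (fun z : G × G => f₁ z.1 * f₂ z.2) (S.μ.prod S.μ) := h₁.mul_prod h₂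
  have hmp : MeasurePreserving (fun z : G × G => (z.1, z.1⁻¹ * z.2)) (S.μ.prod S.μ) (S.μ.prod S.μ) :=
    measurePreserving_prod_inv_mul S.μ S.μ
  have hmeas : AEStronglyMeasurable (fun z : G × G => f₁ z.1 * f₂ z.2) (S.μ.prod S.μ) :=
    ((h₁c.comp continuous_fst).mul (h₂c.comp continuous_snd)).aestronglyMeasurable
  exact (hmp.integrable_comp hmeas).2 hprod

/-- **`L¹ ⋆ L¹ ⊆ L¹`**: the convolution of two `L¹` test functions is integrable (Fubini on the integrand above). -/
theorem integrable_conv_of_integrable {f₁ f₂ : G → ℂ} (h₁c : Continuous f₁) (h₁ : Integrable f₁ S.μ)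
    (h₂c : Continuous f₂) (h₂ : Integrable f₂ S.μ) : Integrable (S.conv f₁ f₂) S.μ := by
  have h := (integrable_conv_integrand_prod S h₁c h₁ h₂c h₂).integral_prod_right
  exact h

/-- **Young's inequality** `‖f₁ ⋆ f₂‖₁ ≤ ‖f₁‖₁ · ‖f₂‖₁` (Fubini on the norm of the integrand and the left invariance
`∫ ‖f₂ (h⁻¹ x)‖ dx = ∫ ‖f₂‖`). -/
theorem integral_norm_conv_le {f₁ f₂ : G → ℂ} (h₁c : Continuous f₁) (h₁ : Integrable f₁ S.μ)
    (h₂c : Continuous f₂) (h₂ : Integrable f₂ S.μ) :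
    ∫ x, ‖S.conv f₁ f₂ x‖ ∂S.μ ≤ (∫ h, ‖f₁ h‖ ∂S.μ) * ∫ x, ‖f₂ x‖ ∂S.μ := by
  haveI := S.haar
  have hint := integrable_conv_integrand_prod S h₁c h₁ h₂c h₂
  have hnorm : Integrable (fun p : G × G => ‖f₁ p.1 * f₂ (p.1⁻¹ * p.2)‖) (S.μ.prod S.μ) := hint.norm
  -- the inner integral of the norm, as a function of `x`, is integrable
  have hinner : Integrable (fun x => ∫ h, ‖f₁ h * f₂ (h⁻¹ * x)‖ ∂S.μ) S.μ := hnorm.integral_prod_right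
  calc ∫ x, ‖S.conv f₁ f₂ x‖ ∂S.μ
      ≤ ∫ x, ∫ h, ‖f₁ h * f₂ (h⁻¹ * x)‖ ∂S.μ ∂S.μ := by
        apply integral_mono_of_nonneg (Eventually.of_forall fun x => norm_nonneg _) hinner
        exact Eventually.of_forall fun x => norm_integral_le_integral_norm _
    _ = ∫ p, ‖f₁ p.1 * f₂ (p.1⁻¹ * p.2)‖ ∂(S.μ.prod S.μ) := (integral_prod_symm _ hnorm).symm
    _ = ∫ h, ∫ x, ‖f₁ h * f₂ (h⁻¹ * x)‖ ∂S.μ ∂S.μ := integral_prod _ hnorm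
    _ = ∫ h, ‖f₁ h‖ * ∫ x, ‖f₂ x‖ ∂S.μ ∂S.μ := by
        congr 1
        funext h
        simp only [norm_mul]
        rw [integral_const_mul]
        congr 1
        exact integral_mul_left_eq_self (fun x => ‖f₂ x‖) h⁻¹
    _ = (∫ h, ‖f₁ h‖ ∂S.μ) * ∫ x, ‖f₂ x‖ ∂S.μ := integral_mul_const _ _

end Young

/-! ## 3. `L¹ ⋆ C_c` is continuous -/

/-- **The convolution of an `L¹` function with a test function is continuous** (dominated convergence in `x`: the
integrand `f₁ h · f₂ (h⁻¹ x)` is continuous in `x` for every `h` and dominated by `‖f₁ h‖ · sup ‖f₂‖`). -/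
theorem continuous_conv_of_integrable_of_isTest [FirstCountableTopology G] {f₁ f₂ : G → ℂ} (h₁c : Continuous f₁)
    (h₁ : Integrable f₁ S.μ) (h₂ : IsTest f₂) : Continuous (S.conv f₁ f₂) := by
  obtain ⟨B, hB⟩ : ∃ B : ℝ, ∀ g, ‖f₂ g‖ ≤ B := by
    obtain ⟨B, hB⟩ := (h₂.cont.norm.bddAbove_range_of_hasCompactSupport h₂.compact.norm)
    exact ⟨B, fun g => hB ⟨g, rfl⟩⟩
  unfold Setting.conv
  refine continuous_of_dominated (bound := fun h => ‖f₁ h‖ * B) ?_ ?_ (h₁.norm.mul_const B) ?_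
  · intro x
    exact (h₁c.mul (h₂.cont.comp (continuous_inv.mul continuous_const))).aestronglyMeasurable
  · intro x
    refine Eventually.of_forall fun h => ?_
    rw [norm_mul]
    exact mul_le_mul_of_nonneg_left (hB _) (norm_nonneg _)
  · refine Eventually.of_forall fun h => ?_
    exact continuous_const.mul (h₂.cont.comp (continuous_const.mul continuous_id))

/-- `L¹ ⋆ C_c ⊆ L¹ ∩ C`: the convolution of an `L¹` test function with a test function is an `L¹` test function. -/
theorem isTestL1_conv [SecondCountableTopology G] [SFinite S.μ] {f₁ f₂ : G → ℂ} (h₁ : IsTestL1 S f₁)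
    (h₂ : IsTest f₂) : IsTestL1 S (S.conv f₁ f₂) :=
  ⟨continuous_conv_of_integrable_of_isTest S h₁.1 h₁.2 h₂,
    integrable_conv_of_integrable S h₁.1 h₁.2 h₂.cont (isTestL1_of_isTest S h₂).2⟩

/-! ## 4. The operator `R(f)` for `f ∈ L¹` and bounded `φ` -/

/-- The integrand of `R(f)φ(y)` is integrable for `f ∈ L¹` and a bounded continuous `φ`. -/
theorem integrable_R_integrand_of_integrable {f φ : G → ℂ} (hf : Integrable f S.μ) (hφc : Continuous φ) {B : ℝ}
    (hB : ∀ x, ‖φ x‖ ≤ B) (y : G) : Integrable (fun g => f g * φ (y * g)) S.μ := by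
  refine hf.mul_bdd (c := B) (hφc.comp (continuous_const.mul continuous_id)).aestronglyMeasurable ?_
  exact Eventually.of_forall fun g => hB _

omit [IsTopologicalGroup G] [BorelSpace G] in
/-- **The trivial bound** `‖R(f)φ(y)‖ ≤ ‖f‖₁ · B` for `f ∈ L¹` and `‖φ‖ ≤ B` (the `IsTest` version is
`RTF.Setting.norm_R_le`). -/
theorem norm_R_le_of_integrable {f φ : G → ℂ} (hf : Integrable f S.μ) {B : ℝ} (hB : ∀ x, ‖φ x‖ ≤ B) (y : G) :
    ‖S.R f φ y‖ ≤ (∫ g, ‖f g‖ ∂S.μ) * B := by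
  unfold Setting.R
  calc ‖∫ g, f g * φ (y * g) ∂S.μ‖ ≤ ∫ g, ‖f g * φ (y * g)‖ ∂S.μ := norm_integral_le_integral_norm _
    _ ≤ ∫ g, ‖f g‖ * B ∂S.μ := by
        apply integral_mono_of_nonneg (Eventually.of_forall fun g => norm_nonneg _) (hf.norm.mul_const B)
        refine Eventually.of_forall fun g => ?_
        show ‖f g * φ (y * g)‖ ≤ ‖f g‖ * B
        rw [norm_mul]
        exact mul_le_mul_of_nonneg_left (hB _) (norm_nonneg _)
    _ = (∫ g, ‖f g‖ ∂S.μ) * B := integral_mul_const _ _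

/-- **`R(f)φ` is continuous** for `f ∈ L¹` and a bounded continuous `φ` (dominated convergence in `y`; no uniform
continuity of `f` and no compact support are used). -/
theorem continuous_R_of_integrable [FirstCountableTopology G] {f φ : G → ℂ} (hf : Integrable f S.μ)
    (hφc : Continuous φ) {B : ℝ} (hB : ∀ x, ‖φ x‖ ≤ B) : Continuous (S.R f φ) := by
  unfold Setting.R
  refine continuous_of_dominated (bound := fun g => ‖f g‖ * B) ?_ ?_ (hf.norm.mul_const B) ?_
  · intro y
    exact (hf.aestronglyMeasurable.mul (hφc.comp (continuous_const.mul continuous_id)).aestronglyMeasurable)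
  · intro y
    refine Eventually.of_forall fun g => ?_
    rw [norm_mul]
    exact mul_le_mul_of_nonneg_left (hB _) (norm_nonneg _)
  · refine Eventually.of_forall fun g => ?_
    exact continuous_const.mul (hφc.comp (continuous_id.mul continuous_const))

/-! ## 5. Conjugation and reflection of a convolution (all functions) -/

omit [IsTopologicalGroup G] [BorelSpace G] in
/-- `cj (f₁ ⋆ f₂) = cj f₁ ⋆ cj f₂` (conjugation commutes with the Bochner integral). -/
theorem cj_conv (f₁ f₂ : G → ℂ) : RTF.cj (S.conv f₁ f₂) = S.conv (RTF.cj f₁) (RTF.cj f₂) := by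
  funext g
  simp only [RTF.cj, Setting.conv, ← integral_conj, map_mul]

/-- `refl (f₁ ⋆ f₂) = refl f₂ ⋆ refl f₁` (the substitution `h ↦ g h`, left invariance of `S.μ`). -/
theorem refl_conv (f₁ f₂ : G → ℂ) : RTF.refl (S.conv f₁ f₂) = S.conv (RTF.refl f₂) (RTF.refl f₁) := by
  haveI := S.haar
  funext g
  simp only [RTF.refl, Setting.conv]
  rw [← integral_mul_left_eq_self (fun h => f₂ h⁻¹ * f₁ (h⁻¹ * g)⁻¹) g]
  congr 1
  funext h
  simp only [mul_inv_rev, inv_inv, inv_mul_cancel_left]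
  ring

end Summit.Ventures.HodgeRepro.Tier4.Common

end
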